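import Mathlib.FieldTheory.Perfect
import Mathlib.LinearAlgebra.Eigenspace.Minpoly
import Literature.NumberTheory.Automorphic.LieAlgebraWeights
import Literature.NumberTheory.Automorphic.LieAlgebraGLDimension
import HarnessLib

/-!
# The tangent space at `1` of `{s x s⁻¹ x⁻¹}` in `GL n`: Springer 5.4.4 for `GL n`

Springer, *Linear Algebraic Groups* (2nd ed.), 5.4.4, proof: for a semisimple `s ∈ GL n` and the
morphism `χ(x) = (s x s⁻¹) x⁻¹`, *"if `G = GL_n` then it is easy to check that (ii) holds"*, i.e.
`L(G_σ) = 𝔤_σ`; what is used afterwards is its consequence `T_e (χ GL_n)‾ ⊆ (Ad s - 1) 𝔤𝔩ₙ`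
("there is `Y ∈ 𝔤𝔩ₙ` with `X = dσ(Y) - Y`"). This file proves that inclusion directly in the
`k`-points vocabulary (namespace `Literature.Automorphic`), through the equations `m(s⁻¹ y) = 0`
satisfied by `y = s x s⁻¹ x⁻¹` (`s⁻¹ y = x s⁻¹ x⁻¹` is conjugate to `s⁻¹`, `m` its minimal
polynomial):

* `matrixPolyDeriv p t Y = ∑ⱼ pⱼ ∑_{i<j} tⁱ Y t^{j-1-i}` — the differential of `Y ↦ p(Y)` at `t`;
  `map_aeval_eq_matrixPolyDeriv`: a point derivation `D` at `a` applied entrywise satisfies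
  `D (p(N)) = Dp_{N(a)} (D N)` (Leibniz for matrices of polynomials);
* `conjEquationIdeal s m` — the ideal generated by the entries of `m(s⁻¹ y)` in `k[y, det⁻¹]`,
  contained (for `m` the minimal polynomial of `s⁻¹`) in the vanishing ideal of `χ(G)` for
  every `G` (`conjEquationIdeal_le_vanishingIdeal`);
* `matrixPolyDeriv_eq_zero_of_mem_tangentSpaceAt` — a tangent vector `v` at `1` of these
  equations satisfies `Dm_{s⁻¹}(s⁻¹ v_x) = 0`;
* **`mem_range_adGL_sub_one_of_matrixPolyDeriv_eq_zero`** — the linear algebra: for `s`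
  semisimple over an algebraically closed field, `Dm_{s⁻¹}(s⁻¹ Y) = 0` forces
  `Y ∈ (Ad s - 1) 𝔤𝔩ₙ` (simultaneous eigenspaces `E_{a,b} = {Y | s⁻¹ Y = a Y, Y s⁻¹ = b Y}` of
  the commuting semisimple pair `L_{s⁻¹}, R_{s⁻¹}`: on `E_{a,b}` the operator is the scalar
  `a · (m(a) - m(b))/(a - b) = 0` for `a ≠ b` and `a · m'(a) ≠ 0` for `a = b`, `m` being
  separable; and `E_{a,b} ⊆ (Ad s - 1) 𝔤𝔩ₙ` for `a ≠ b`);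
* **`matrixOfCoord_mem_range_of_mem_tangentSpaceAt_conjEquationIdeal`**,
  **`matrixOfCoord_mem_range_adGL_sub_one`** — hence every tangent vector at `1` of the variety
  `m(s⁻¹ y) = 0`, in particular (by antitonicity) of the closure of `χ(G)`, has matrix part in
  `(Ad s - 1) 𝔤𝔩ₙ` (Springer 5.4.4, the `GL_n` step).

Consumer: `CentralizerLieAlgebra.lean` (Springer 5.4.4 (ii), 5.4.5, 5.4.7: `L(Z_G(s)) = 𝔤^s`).

## References

* T. A. Springer, *Linear Algebraic Groups*, 2nd ed., Progress in Mathematics 9, Birkhäuser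
  (1998), 5.4.1, 5.4.4 (proof) [SpringerLAG1998].
-/

noncomputable section

open Polynomial Module

namespace Literature.NumberTheory.Automorphic

variable {k : Type*} [Field k] {n : Type*} [Fintype n] [DecidableEq n]

/-! ### The differential of a matrix polynomial -/

section MatrixPolyDeriv

variable {R : Type*} [CommRing R]

/-- The differential at `t` in the direction `Y` of the matrix polynomial map `N ↦ p(N)`:
`Dp_t(Y) = ∑ⱼ pⱼ ∑_{i<j} tⁱ Y t^{j-1-i}` (the linear term of `p(t + ε Y)`). [folklore] -/
def matrixPolyDeriv (p : R[X]) (t Y : Matrix n n R) : Matrix n n R :=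
  ∑ j ∈ Finset.range (p.natDegree + 1),
    p.coeff j • ∑ i ∈ Finset.range j, t ^ i * Y * t ^ (j - 1 - i)

/-- `matrixPolyDeriv` is additive in the direction. [folklore] -/
lemma matrixPolyDeriv_add (p : R[X]) (t Y Y' : Matrix n n R) :
    matrixPolyDeriv p t (Y + Y') = matrixPolyDeriv p t Y + matrixPolyDeriv p t Y' := by
  simp only [matrixPolyDeriv, Matrix.mul_add, Matrix.add_mul, Finset.sum_add_distrib, smul_add]

/-- `matrixPolyDeriv` is homogeneous in the direction. [folklore] -/
lemma matrixPolyDeriv_smul (p : R[X]) (t : Matrix n n R) (c : R) (Y : Matrix n n R) :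
    matrixPolyDeriv p t (c • Y) = c • matrixPolyDeriv p t Y := by
  simp only [matrixPolyDeriv, Matrix.mul_smul, Matrix.smul_mul, ← Finset.smul_sum]
  rw [Finset.smul_sum]
  exact Finset.sum_congr rfl fun j _ => smul_comm _ _ _

/-- `Dp_t` as a linear map in the direction. [folklore] -/
def matrixPolyDerivLin (p : R[X]) (t : Matrix n n R) : Matrix n n R →ₗ[R] Matrix n n R where
  toFun := matrixPolyDeriv p t
  map_add' := matrixPolyDeriv_add p t
  map_smul' := matrixPolyDeriv_smul p t

/-- Unfolding `matrixPolyDerivLin`. [folklore] -/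
@[simp] lemma matrixPolyDerivLin_apply (p : R[X]) (t Y : Matrix n n R) :
    matrixPolyDerivLin p t Y = matrixPolyDeriv p t Y := rfl

end MatrixPolyDeriv

/-! ### Point derivations applied to matrices of polynomials -/

section MatrixDerivation

variable {σ : Type*} (a : σ → k) {D : MvPolynomial σ k →ₗ[k] k}

omit [DecidableEq n] in
/-- **Leibniz rule for matrices**: a point derivation `D` at `a`, applied entrywise, satisfies
`D(M N) = D(M) N(a) + M(a) D(N)`. [folklore] -/
lemma map_mul_of_mem_pointDerivations (hD : D ∈ Literature.RingTheory.KrullDimension.pointDerivations (MvPolynomial.aeval a))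
    (M N : Matrix n n (MvPolynomial σ k)) :
    (M * N).map D = M.map D * N.map (MvPolynomial.eval a) + M.map (MvPolynomial.eval a) * N.map D := by
  ext i j
  simp only [Matrix.map_apply, Matrix.mul_apply, Matrix.add_apply, map_sum]
  rw [← Finset.sum_add_distrib]
  refine Finset.sum_congr rfl fun l _ => ?_
  rw [hD, Literature.RingTheory.KrullDimension.aeval_apply_eq_eval, Literature.RingTheory.KrullDimension.aeval_apply_eq_eval]
  ring

/-- `D(N^j) = ∑_{i<j} N(a)ⁱ D(N) N(a)^{j-1-i}`. [folklore] -/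
lemma map_pow_of_mem_pointDerivations (hD : D ∈ Literature.RingTheory.KrullDimension.pointDerivations (MvPolynomial.aeval a))
    (N : Matrix n n (MvPolynomial σ k)) (j : ℕ) :
    (N ^ j).map D = ∑ i ∈ Finset.range j,
      N.map (MvPolynomial.eval a) ^ i * N.map D * N.map (MvPolynomial.eval a) ^ (j - 1 - i) := by
  induction j with
  | zero =>
    rw [pow_zero, Finset.range_zero, Finset.sum_empty]
    ext i j
    simp only [Matrix.map_apply, Matrix.zero_apply, Matrix.one_apply]
    split_ifs
    · rw [← MvPolynomial.C_1, ← MvPolynomial.algebraMap_eq]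
      exact Literature.RingTheory.KrullDimension.pointDerivations.apply_algebraMap hD 1
    · exact map_zero D
  | succ j ih =>
    have hpow : ∀ l, (N ^ l).map (MvPolynomial.eval a) = N.map (MvPolynomial.eval a) ^ l :=
      fun l => by rw [← RingHom.mapMatrix_apply, map_pow, RingHom.mapMatrix_apply]
    rw [pow_succ, map_mul_of_mem_pointDerivations a hD, ih, hpow, Finset.sum_range_succ,
      Nat.add_sub_cancel, Nat.sub_self, pow_zero, mul_one, Finset.sum_mul]
    congr 1
    refine Finset.sum_congr rfl fun i hi => ?_
    have hij : i < j := Finset.mem_range.1 hi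
    rw [mul_assoc, ← pow_succ]
    congr 2
    omega

/-- **`D(p(N)) = Dp_{N(a)}(D(N))`**: a point derivation applied entrywise to a matrix polynomial
is the differential of the polynomial at the value. [folklore] -/
theorem map_aeval_eq_matrixPolyDeriv (hD : D ∈ Literature.RingTheory.KrullDimension.pointDerivations (MvPolynomial.aeval a))
    (N : Matrix n n (MvPolynomial σ k)) (p : k[X]) :
    (Polynomial.aeval N p).map D =
      matrixPolyDeriv p (N.map (MvPolynomial.eval a)) (N.map D) := by
  rw [Polynomial.aeval_eq_sum_range, matrixPolyDeriv, ← LinearMap.mapMatrix_apply, map_sum]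
  refine Finset.sum_congr rfl fun j _ => ?_
  rw [map_smul, LinearMap.mapMatrix_apply, map_pow_of_mem_pointDerivations a hD]

end MatrixDerivation

/-! ### The equations `m(s⁻¹ y) = 0` of the commutator image `{s x s⁻¹ x⁻¹}` -/

section Equations

/-- A constant matrix `t` viewed in the coordinate ring: entries `C (t i j)`. [folklore] -/
def constMatrixGL (t : Matrix n n k) : Matrix n n (MvPolynomial (GLCoord n) k) :=
  t.map MvPolynomial.C

omit [Fintype n] [DecidableEq n] in
/-- Evaluating the constant matrix gives it back. [folklore] -/
@[simp] lemma eval_constMatrixGL (t : Matrix n n k) (a : GLCoord n → k) :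
    (constMatrixGL t).map (MvPolynomial.eval a) = t := by
  ext i j; simp [constMatrixGL]

omit [Fintype n] [DecidableEq n] in
/-- A point derivation kills constant matrices. [folklore] -/
lemma map_constMatrixGL_eq_zero {a : GLCoord n → k} {D : MvPolynomial (GLCoord n) k →ₗ[k] k}
    (hD : D ∈ Literature.RingTheory.KrullDimension.pointDerivations (MvPolynomial.aeval a)) (t : Matrix n n k) :
    (constMatrixGL t).map D = 0 := by
  ext i j
  simp only [constMatrixGL, Matrix.map_apply, Matrix.zero_apply]
  rw [← MvPolynomial.algebraMap_eq]
  exact Literature.RingTheory.KrullDimension.pointDerivations.apply_algebraMap hD _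

/-- The matrix polynomial `m(s⁻¹ y)` in the coordinates `y` of `GL n`, for a polynomial `m`
(Springer 5.4.4, proof: the equations `m(x) = 0` of the set `S`). [folklore] -/
def conjEquationMatrix (s : GL n k) (m : k[X]) : Matrix n n (MvPolynomial (GLCoord n) k) :=
  Polynomial.aeval (constMatrixGL ((s⁻¹ : GL n k) : Matrix n n k) * genericMatrixGL n k) m

/-- The ideal of `k[y, det⁻¹]` generated by the entries of `m(s⁻¹ y)`. [folklore] -/
def conjEquationIdeal (s : GL n k) (m : k[X]) : Ideal (MvPolynomial (GLCoord n) k) :=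
  Ideal.span (Set.range fun ij : n × n => conjEquationMatrix s m ij.1 ij.2)

/-- Evaluating `m(s⁻¹ y)` at the coordinates of `g` gives `m(s⁻¹ g)`. [folklore] -/
lemma eval_conjEquationMatrix (s g : GL n k) (m : k[X]) :
    (conjEquationMatrix s m).map (MvPolynomial.eval (glCoordFun g)) =
      Polynomial.aeval (((s⁻¹ : GL n k) : Matrix n n k) * (g : Matrix n n k)) m := by
  have h1 : (conjEquationMatrix s m).map (MvPolynomial.eval (glCoordFun g)) =
      (MvPolynomial.aeval (glCoordFun g)).mapMatrix (conjEquationMatrix s m) := by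
    rw [AlgHom.mapMatrix_apply]; rfl
  rw [h1, conjEquationMatrix,
    ← Polynomial.aeval_algHom_apply ((MvPolynomial.aeval (glCoordFun g)).mapMatrix),
    AlgHom.mapMatrix_apply, Matrix.map_mul]
  have h2 : (genericMatrixGL n k).map (MvPolynomial.aeval (glCoordFun g)) = (g : Matrix n n k) := by
    have h := eval_mapMatrix_genericMatrixGL g
    rw [RingHom.mapMatrix_apply] at h
    exact h
  have h3 : (constMatrixGL ((s⁻¹ : GL n k) : Matrix n n k)).map (MvPolynomial.aeval (glCoordFun g)) =
      ((s⁻¹ : GL n k) : Matrix n n k) := eval_constMatrixGL _ _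
  rw [h2, h3]

/-- **The commutators `s x s⁻¹ x⁻¹` satisfy `m(s⁻¹ y) = 0` for `m` the minimal polynomial of
`s⁻¹`** (`s⁻¹ · s x s⁻¹ x⁻¹ = x s⁻¹ x⁻¹` is conjugate to `s⁻¹`; Springer 5.4.4, proof:
"`m(x) = 0`"). [cite: SpringerLAG1998, 5.4.4 (proof)] -/
lemma aeval_minpoly_inv_mul_conj (s x : GL n k) :
    Polynomial.aeval (((s⁻¹ : GL n k) : Matrix n n k) *
      ((s * x * s⁻¹ * x⁻¹ : GL n k) : Matrix n n k))
      (minpoly k ((s⁻¹ : GL n k) : Matrix n n k)) = 0 := by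
  have hconj : ((s⁻¹ : GL n k) : Matrix n n k) * ((s * x * s⁻¹ * x⁻¹ : GL n k) : Matrix n n k) =
      (x : Matrix n n k) * ((s⁻¹ : GL n k) : Matrix n n k) * ((x⁻¹ : GL n k) : Matrix n n k) := by
    simp only [Units.val_mul, ← mul_assoc, Units.inv_mul, one_mul]
  rw [hconj]
  -- conjugation by `x` is an algebra automorphism of `Matrix n n k`
  let φ : Matrix n n k →ₐ[k] Matrix n n k :=
    { toFun := fun N => (x : Matrix n n k) * N * ((x⁻¹ : GL n k) : Matrix n n k)
      map_one' := by rw [mul_one, ← Units.val_mul, mul_inv_cancel, Units.val_one]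
      map_mul' := fun M N => by
        simp only [mul_assoc]
        rw [← mul_assoc ((x⁻¹ : GL n k) : Matrix n n k) (x : Matrix n n k), ← Units.val_mul,
          inv_mul_cancel, Units.val_one, one_mul]
      map_zero' := by rw [mul_zero, zero_mul]
      map_add' := fun M N => by rw [mul_add, add_mul]
      commutes' := fun c => by
        rw [Algebra.algebraMap_eq_smul_one, mul_smul_comm, mul_one, smul_mul_assoc,
          ← Units.val_mul, mul_inv_cancel, Units.val_one] }
  have h := Polynomial.aeval_algHom_apply φ ((s⁻¹ : GL n k) : Matrix n n k)
    (minpoly k ((s⁻¹ : GL n k) : Matrix n n k))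
  rw [minpoly.aeval, map_zero] at h
  exact h

variable {G : Subgroup (GL n k)}

/-- **The equations lie in the vanishing ideal of the commutator image**: if `s` normalises `G`,
every entry of `m(s⁻¹ y)` (`m` the minimal polynomial of `s⁻¹`) vanishes on
`χ(G) = {s x s⁻¹ x⁻¹ | x ∈ G}`. [folklore] -/
theorem conjEquationIdeal_le_vanishingIdeal (s : GL n k) :
    conjEquationIdeal s (minpoly k ((s⁻¹ : GL n k) : Matrix n n k)) ≤
      MvPolynomial.vanishingIdeal k
        (glCoordFun '' ((fun x : GL n k => s * x * s⁻¹ * x⁻¹) '' (G : Set (GL n k)))) := by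
  refine Ideal.span_le.2 ?_
  rintro _ ⟨⟨i, j⟩, rfl⟩
  rw [SetLike.mem_coe, MvPolynomial.mem_vanishingIdeal_iff]
  rintro _ ⟨_, ⟨x, hx, rfl⟩, rfl⟩
  have h := congrFun (congrFun (eval_conjEquationMatrix s (s * x * s⁻¹ * x⁻¹)
    (minpoly k ((s⁻¹ : GL n k) : Matrix n n k))) i) j
  rw [Matrix.map_apply, aeval_minpoly_inv_mul_conj] at h
  exact h

end Equations

/-! ### Tangent vectors at `1` of the equations satisfy `Dm_{s⁻¹}(s⁻¹ Y) = 0` -/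

section TangentEquation

/-- If `v` is tangent at `1` to the equations `m(s⁻¹ y) = 0`, its matrix part `Y = v_x`
satisfies `Dm_{s⁻¹}(s⁻¹ Y) = 0` (apply the point derivation `f ↦ ∑ ∂f/∂c (1) v_c` entrywise to
`m(s⁻¹ y)`; Leibniz for matrices). [folklore] -/
theorem matrixPolyDeriv_eq_zero_of_mem_tangentSpaceAt (s : GL n k) (m : k[X]) {v : GLCoord n → k}
    (hv : v ∈ Literature.RingTheory.KrullDimension.tangentSpaceAt (conjEquationIdeal s m) (glCoordFun (1 : GL n k))) :
    matrixPolyDeriv m ((s⁻¹ : GL n k) : Matrix n n k)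
      (((s⁻¹ : GL n k) : Matrix n n k) * matrixOfCoord v) = 0 := by
  set a := glCoordFun (1 : GL n k)
  set D := Literature.RingTheory.KrullDimension.linearFormOfVector a v with hD
  have hDmem : D ∈ Literature.RingTheory.KrullDimension.pointDerivations (MvPolynomial.aeval a) := Literature.RingTheory.KrullDimension.linearFormOfVector_mem a v
  -- `D` kills the generators
  have hgen : (conjEquationMatrix s m).map D = 0 := by
    ext i j
    rw [Matrix.map_apply, Matrix.zero_apply, hD, Literature.RingTheory.KrullDimension.linearFormOfVector_apply]
    exact hv _ (Ideal.subset_span ⟨(i, j), rfl⟩)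
  -- compute it by the Leibniz rule
  set N := constMatrixGL ((s⁻¹ : GL n k) : Matrix n n k) * genericMatrixGL n k with hN
  have hNa : N.map (MvPolynomial.eval a) = ((s⁻¹ : GL n k) : Matrix n n k) := by
    rw [hN, Matrix.map_mul, eval_constMatrixGL]
    have h := eval_mapMatrix_genericMatrixGL (1 : GL n k)
    rw [RingHom.mapMatrix_apply] at h
    rw [h, Units.val_one, mul_one]
  have hND : N.map D = ((s⁻¹ : GL n k) : Matrix n n k) * matrixOfCoord v := by
    rw [hN, map_mul_of_mem_pointDerivations a hDmem, map_constMatrixGL_eq_zero hDmem, zero_mul,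
      zero_add, eval_constMatrixGL]
    congr 1
    ext i j
    simp only [Matrix.map_apply, genericMatrixGL, Matrix.of_apply, hD, Literature.RingTheory.KrullDimension.linearFormOfVector_X,
      matrixOfCoord]
  have h := map_aeval_eq_matrixPolyDeriv a hDmem N m
  change (Polynomial.aeval N m).map D = 0 at hgen
  rw [hgen, hNa, hND] at h
  exact h.symm

end TangentEquation

/-! ### The linear algebra: `Dm_{s⁻¹}(s⁻¹ Y) = 0` forces `Y ∈ (Ad s - 1) 𝔤𝔩ₙ` -/

section LinearAlgebra

variable (t : Matrix n n k)

/-- The simultaneous eigenspace `E_χ = {Y | t Y = a Y, Y t = b Y}` (`a = χ true`, `b = χ false`)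
of the commuting pair `L_t, R_t` on `𝔤𝔩ₙ`. [folklore] -/
def lrEigenspace (χ : Bool → k) : Submodule k (Matrix n n k) :=
  ⨅ b : Bool, Module.End.eigenspace (if b then LinearMap.mulLeft k t else LinearMap.mulRight k t) (χ b)

variable {t}

/-- Membership in `E_χ`. [folklore] -/
lemma mem_lrEigenspace_iff {χ : Bool → k} {Y : Matrix n n k} :
    Y ∈ lrEigenspace t χ ↔ t * Y = χ true • Y ∧ Y * t = χ false • Y := by
  simp only [lrEigenspace, Submodule.mem_iInf, Module.End.mem_eigenspace_iff, Bool.forall_bool,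
    if_true, LinearMap.mulLeft_apply]
  exact and_comm

/-- Powers: `tⁱ Y = aⁱ Y` on `E_χ`. [folklore] -/
lemma pow_mul_of_mem_lrEigenspace {χ : Bool → k} {Y : Matrix n n k} (hY : Y ∈ lrEigenspace t χ)
    (i : ℕ) : t ^ i * Y = χ true ^ i • Y := by
  induction i with
  | zero => rw [pow_zero, pow_zero, one_mul, one_smul]
  | succ i ih => rw [pow_succ, mul_assoc, (mem_lrEigenspace_iff.1 hY).1, Matrix.mul_smul, ih,
      smul_smul, pow_succ, mul_comm]

/-- Powers: `Y tⁱ = bⁱ Y` on `E_χ`. [folklore] -/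
lemma mul_pow_of_mem_lrEigenspace {χ : Bool → k} {Y : Matrix n n k} (hY : Y ∈ lrEigenspace t χ)
    (i : ℕ) : Y * t ^ i = χ false ^ i • Y := by
  induction i with
  | zero => rw [pow_zero, pow_zero, mul_one, one_smul]
  | succ i ih => rw [pow_succ', ← mul_assoc, (mem_lrEigenspace_iff.1 hY).2, Matrix.smul_mul, ih,
      smul_smul, pow_succ, mul_comm]

/-- The divided difference `Φ_p(a, b) = ∑ⱼ pⱼ ∑_{i<j} aⁱ b^{j-1-i}` (`= (p(a) - p(b))/(a - b)`
for `a ≠ b`, `= p'(a)` for `a = b`). [folklore] -/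
def dividedDiff (p : k[X]) (a b : k) : k :=
  ∑ j ∈ Finset.range (p.natDegree + 1), p.coeff j * ∑ i ∈ Finset.range j, a ^ i * b ^ (j - 1 - i)

/-- `Φ_p(a, b) (a - b) = p(a) - p(b)`. [folklore] -/
lemma dividedDiff_mul_sub (p : k[X]) (a b : k) :
    dividedDiff p a b * (a - b) = p.eval a - p.eval b := by
  rw [dividedDiff, Finset.sum_mul, Polynomial.eval_eq_sum_range, Polynomial.eval_eq_sum_range,
    ← Finset.sum_sub_distrib]
  refine Finset.sum_congr rfl fun j _ => ?_
  rw [mul_assoc, geom_sum₂_mul, mul_sub]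

/-- `Φ_p(a, a) = p'(a)`. [folklore] -/
lemma dividedDiff_self (p : k[X]) (a : k) : dividedDiff p a a = p.derivative.eval a := by
  rw [dividedDiff, Polynomial.derivative_eval, Polynomial.sum_over_range _ (fun j => by simp)]
  refine Finset.sum_congr rfl fun j _ => ?_
  have h : ∑ i ∈ Finset.range j, a ^ i * a ^ (j - 1 - i) = (j : k) * a ^ (j - 1) := by
    have h' : ∀ i ∈ Finset.range j, a ^ i * a ^ (j - 1 - i) = a ^ (j - 1) := fun i hi => by
      have hij := Finset.mem_range.1 hi
      rw [← pow_add, show i + (j - 1 - i) = j - 1 from by omega]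
    rw [Finset.sum_congr rfl h', Finset.sum_const, Finset.card_range, nsmul_eq_mul]
  rw [h]
  ring

/-- **On `E_χ` the operator `Y ↦ Dm_t(t Y)` is the scalar `a Φ_m(a, b)`.** [folklore] -/
lemma matrixPolyDeriv_mul_of_mem_lrEigenspace (p : k[X]) {χ : Bool → k} {Y : Matrix n n k}
    (hY : Y ∈ lrEigenspace t χ) :
    matrixPolyDeriv p t (t * Y) = (χ true * dividedDiff p (χ true) (χ false)) • Y := by
  rw [matrixPolyDeriv, dividedDiff]
  simp only [Finset.mul_sum, Finset.sum_smul, Finset.smul_sum]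
  refine Finset.sum_congr rfl fun j _ => Finset.sum_congr rfl fun i _ => ?_
  rw [← mul_assoc (t ^ i), ← pow_succ, pow_mul_of_mem_lrEigenspace hY, Matrix.smul_mul,
    mul_pow_of_mem_lrEigenspace hY, smul_smul, smul_smul, pow_succ]
  congr 1
  ring

/-- If `E_χ ≠ 0` then `a` and `b` are roots of the minimal polynomial of `t`, and `a ≠ 0` if `t`
is invertible. [folklore] -/
lemma eval_minpoly_eq_zero_of_mem_lrEigenspace {χ : Bool → k} {Y : Matrix n n k}
    (hY : Y ∈ lrEigenspace t χ) (hY0 : Y ≠ 0) :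
    (minpoly k t).eval (χ true) = 0 ∧ (minpoly k t).eval (χ false) = 0 := by
  obtain ⟨h1, h2⟩ := mem_lrEigenspace_iff.1 hY
  constructor
  · have hev : Module.End.HasEigenvector (LinearMap.mulLeft k t) (χ true) Y :=
      ⟨Module.End.mem_eigenspace_iff.2 (by rw [LinearMap.mulLeft_apply, h1]), hY0⟩
    have h := Module.End.aeval_apply_of_hasEigenvector (p := minpoly k t) hev
    rw [aeval_mulLeft_apply, minpoly.aeval, zero_mul] at h
    exact ((smul_eq_zero.1 h.symm).resolve_right hY0)
  · have hev : Module.End.HasEigenvector (LinearMap.mulRight k t) (χ false) Y :=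
      ⟨Module.End.mem_eigenspace_iff.2 (by rw [LinearMap.mulRight_apply, h2]), hY0⟩
    have h := Module.End.aeval_apply_of_hasEigenvector (p := minpoly k t) hev
    rw [aeval_mulRight_apply, minpoly.aeval, mul_zero] at h
    exact ((smul_eq_zero.1 h.symm).resolve_right hY0)

/-- If `t` is invertible and `E_χ ∋ Y ≠ 0` then `a ≠ 0`. [folklore] -/
lemma ne_zero_of_mem_lrEigenspace (s : GL n k) {χ : Bool → k} {Y : Matrix n n k}
    (hY : Y ∈ lrEigenspace ((s⁻¹ : GL n k) : Matrix n n k) χ) (hY0 : Y ≠ 0) : χ true ≠ 0 := by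
  intro h0
  obtain ⟨h1, -⟩ := mem_lrEigenspace_iff.1 hY
  rw [h0, zero_smul] at h1
  apply hY0
  have h := congrArg (fun M => (s : Matrix n n k) * M) h1
  simpa only [← mul_assoc, ← Units.val_mul, mul_inv_cancel, Units.val_one, one_mul,
    mul_zero] using h

/-- **`E_χ ⊆ (Ad s - 1) 𝔤𝔩ₙ` for `a ≠ b`** (`t = s⁻¹`): on `E_χ`, `Ad s` is the scalar `b/a`, so
`Ad s - 1` is the non-zero scalar `b/a - 1`. [folklore] -/
lemma mem_range_adGL_sub_one_of_mem_lrEigenspace (s : GL n k) {χ : Bool → k} {Y : Matrix n n k}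
    (hY : Y ∈ lrEigenspace ((s⁻¹ : GL n k) : Matrix n n k) χ) (hab : χ true ≠ χ false)
    (ha : χ true ≠ 0) : Y ∈ LinearMap.range (adGL s - 1) := by
  obtain ⟨h1, h2⟩ := mem_lrEigenspace_iff.1 hY
  have hsY : (s : Matrix n n k) * Y = (χ true)⁻¹ • Y := by
    have h := congrArg (fun M => (χ true)⁻¹ • ((s : Matrix n n k) * M)) h1
    simp only [← mul_assoc, ← Units.val_mul, mul_inv_cancel, Units.val_one, one_mul,
      Matrix.mul_smul, smul_smul, inv_mul_cancel₀ ha, one_smul] at h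
    exact h.symm
  set c : k := χ false * (χ true)⁻¹ - 1 with hc
  have hc0 : c ≠ 0 := by
    rw [hc, sub_ne_zero]
    intro h
    apply hab
    have := congrArg (fun x => x * χ true) h
    rwa [mul_assoc, inv_mul_cancel₀ ha, mul_one, one_mul, eq_comm] at this
  have hAd : (adGL s - 1) Y = c • Y := by
    rw [LinearMap.sub_apply, Module.End.one_apply, adGL_apply, mul_assoc, h2, Matrix.mul_smul,
      hsY, smul_smul, hc, sub_smul, one_smul]
  refine ⟨c⁻¹ • Y, ?_⟩
  rw [map_smul, hAd, smul_smul, inv_mul_cancel₀ hc0, one_smul]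

variable [IsAlgClosed k]

/-- `𝔤𝔩ₙ = ⨆_χ E_χ` for semisimple `t` (simultaneous eigenspace decomposition of the commuting
semisimple pair `L_t, R_t`). [folklore] -/
theorem iSup_lrEigenspace_eq_top (ht : Module.End.IsSemisimple (Matrix.toLin' t)) :
    ⨆ χ : Bool → k, lrEigenspace t χ = ⊤ := by
  set f : Bool → Module.End k (Matrix n n k) := fun b =>
    if b then LinearMap.mulLeft k t else LinearMap.mulRight k t with hf
  have hss : ∀ b, (f b).IsSemisimple := by
    intro b; cases b
    · exact isSemisimple_mulRight ht
    · exact isSemisimple_mulLeft ht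
  have hcomm : Pairwise fun b b' : Bool => Commute (f b) (f b') := by
    intro b b' _
    cases b <;> cases b'
    · exact Commute.refl _
    · exact (LinearMap.commute_mulLeft_right _ _).symm
    · exact LinearMap.commute_mulLeft_right _ _
    · exact Commute.refl _
  have h' : ∀ b, ⨆ μ : k, (f b).maxGenEigenspace μ = ⊤ := fun b =>
    Module.End.iSup_maxGenEigenspace_eq_top (f b)
  have key :=
    Module.End.iSup_iInf_maxGenEigenspace_eq_top_of_iSup_maxGenEigenspace_eq_top_of_commute
      f hcomm h'
  have e : ∀ χ : Bool → k, (⨅ b, (f b).maxGenEigenspace (χ b)) = lrEigenspace t χ :=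
    fun χ => iInf_congr fun b => (hss b).isFinitelySemisimple.maxGenEigenspace_eq_eigenspace (χ b)
  simpa only [e] using key

omit [IsAlgClosed k] in
/-- The `E_χ` are independent. [folklore] -/
theorem iSupIndep_lrEigenspace [PerfectField k] (ht : Module.End.IsSemisimple (Matrix.toLin' t)) :
    iSupIndep fun χ : Bool → k => lrEigenspace t χ := by
  set f : Bool → Module.End k (Matrix n n k) := fun b =>
    if b then LinearMap.mulLeft k t else LinearMap.mulRight k t with hf
  have hss : ∀ b, (f b).IsSemisimple := by
    intro b; cases b
    · exact isSemisimple_mulRight ht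
    · exact isSemisimple_mulLeft ht
  have hcomm : ∀ b b' : Bool, Commute (f b) (f b') := by
    intro b b'
    cases b <;> cases b'
    · exact Commute.refl _
    · exact (LinearMap.commute_mulLeft_right _ _).symm
    · exact LinearMap.commute_mulLeft_right _ _
    · exact Commute.refl _
  have hind := Module.End.independent_iInf_maxGenEigenspace_of_forall_mapsTo f
    (fun i j φ => Module.End.mapsTo_maxGenEigenspace_of_comm (hcomm j i) φ)
  have e : ∀ χ : Bool → k, (⨅ b, (f b).maxGenEigenspace (χ b)) = lrEigenspace t χ :=
    fun χ => iInf_congr fun b => (hss b).isFinitelySemisimple.maxGenEigenspace_eq_eigenspace (χ b)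
  simpa only [e] using hind

omit [IsAlgClosed k] in
/-- An independent family: a finitely supported sum `∑ fᵢ = 0` with `fᵢ ∈ pᵢ` has all
`fᵢ = 0`. [folklore] -/
lemma eq_zero_of_iSupIndep_of_sum_eq_zero {ι M : Type*} [AddCommGroup M] [Module k M]
    {p : ι → Submodule k M} (hp : iSupIndep p) (f : ι →₀ M) (hf : ∀ i, f i ∈ p i)
    (h0 : (f.sum fun _ x => x) = 0) (i : ι) : f i = 0 := by
  classical
  by_cases hi : i ∈ f.support
  · have hsplit : f i = - ∑ j ∈ f.support.erase i, f j := by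
      rw [Finsupp.sum, ← Finset.add_sum_erase _ _ hi] at h0
      exact eq_neg_of_add_eq_zero_left h0
    have hmem : f i ∈ ⨆ (j) (_ : j ≠ i), p j := by
      rw [hsplit]
      refine Submodule.neg_mem _ (Submodule.sum_mem _ fun j hj => ?_)
      have hji : j ≠ i := Finset.ne_of_mem_erase hj
      exact Submodule.mem_iSup_of_mem j (Submodule.mem_iSup_of_mem hji (hf j))
    have hd := hp i
    rw [Submodule.disjoint_def] at hd
    exact hd _ (hf i) hmem
  · simpa using hi

/-- **Springer 5.4.4 for `GL_n`, the linear algebra**: for `s` semisimple over an algebraically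
closed field, with `t = s⁻¹` and `m` the minimal polynomial of `t`, if `Dm_t(t Y) = 0` then
`Y ∈ (Ad s - 1) 𝔤𝔩ₙ`. [cite: SpringerLAG1998, 5.4.4 (proof)] -/
theorem mem_range_adGL_sub_one_of_matrixPolyDeriv_eq_zero {s : GL n k} (hs : IsSemisimpleElt s)
    (Y : Matrix n n k)
    (hY : matrixPolyDeriv (minpoly k ((s⁻¹ : GL n k) : Matrix n n k)) ((s⁻¹ : GL n k) : Matrix n n k)
      (((s⁻¹ : GL n k) : Matrix n n k) * Y) = 0) :
    Y ∈ LinearMap.range (adGL s - 1) := by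
  classical
  set t : Matrix n n k := ((s⁻¹ : GL n k) : Matrix n n k) with htdef
  set m : k[X] := minpoly k t with hmdef
  have ht : Module.End.IsSemisimple (Matrix.toLin' t) := hs.inv_of_perfectField
  -- `m` is separable
  have hsep : m.Separable := by
    rw [PerfectField.separable_iff_squarefree, hmdef, ← Matrix.minpoly_toLin']
    exact ht.minpoly_squarefree
  -- decompose `Y` along the `E_χ`
  have hYtop : Y ∈ ⨆ χ : Bool → k, lrEigenspace t χ := by
    rw [iSup_lrEigenspace_eq_top ht]; exact Submodule.mem_top
  obtain ⟨f, hf, hfsum⟩ := (Submodule.mem_iSup_iff_exists_finsupp _ Y).1 hYtop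
  -- the scalars
  let μ : (Bool → k) → k := fun χ => χ true * dividedDiff m (χ true) (χ false)
  -- `∑ μ_χ f_χ = Dm_t(t Y) = 0`
  let g : (Bool → k) →₀ Matrix n n k := Finsupp.onFinset f.support (fun χ => μ χ • f χ)
    (fun χ hχ => by
      by_contra h
      rw [Finsupp.notMem_support_iff] at h
      exact hχ (by rw [h, smul_zero]))
  have hg : ∀ χ, g χ ∈ lrEigenspace t χ := fun χ => Submodule.smul_mem _ _ (hf χ)
  have hgsum : (g.sum fun _ x => x) = 0 := by
    have h1 : (g.sum fun _ x => x) = ∑ χ ∈ f.support, μ χ • f χ := by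
      rw [Finsupp.sum, Finsupp.support_onFinset]
      rw [Finset.sum_filter]
      refine Finset.sum_congr rfl fun χ _ => ?_
      simp only [Finsupp.onFinset_apply, g]
      split_ifs with h
      · rfl
      · push Not at h; exact h.symm
    have h2 : ∑ χ ∈ f.support, μ χ • f χ =
        ∑ χ ∈ f.support, matrixPolyDeriv m t (t * f χ) :=
      Finset.sum_congr rfl fun χ _ => (matrixPolyDeriv_mul_of_mem_lrEigenspace m (hf χ)).symm
    have h3 : ∑ χ ∈ f.support, matrixPolyDeriv m t (t * f χ) =
        matrixPolyDeriv m t (t * ∑ χ ∈ f.support, f χ) := by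
      rw [Finset.mul_sum, ← matrixPolyDerivLin_apply, map_sum]
      simp only [matrixPolyDerivLin_apply]
    rw [h1, h2, h3]
    have h4 : ∑ χ ∈ f.support, f χ = Y := hfsum
    rw [h4]
    exact hY
  have hzero : ∀ χ, μ χ • f χ = 0 := fun χ => by
    have h := eq_zero_of_iSupIndep_of_sum_eq_zero (iSupIndep_lrEigenspace ht) g hg hgsum χ
    simpa only [g, Finsupp.onFinset_apply] using h
  -- the components with `a = b` vanish, the others lie in the range
  rw [← hfsum, Finsupp.sum]
  refine Submodule.sum_mem _ fun χ _ => ?_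
  by_cases h0 : f χ = 0
  · rw [h0]; exact zero_mem _
  have ha0 : χ true ≠ 0 := ne_zero_of_mem_lrEigenspace s (hf χ) h0
  by_cases hab : χ true = χ false
  · exfalso
    obtain ⟨hra, -⟩ := eval_minpoly_eq_zero_of_mem_lrEigenspace (hf χ) h0
    have hder : m.derivative.eval (χ true) ≠ 0 :=
      hsep.eval₂_derivative_ne_zero (RingHom.id k) (by rwa [Polynomial.eval₂_id])
    have hμ : μ χ ≠ 0 := by
      change χ true * dividedDiff m (χ true) (χ false) ≠ 0
      rw [← hab, dividedDiff_self]
      exact mul_ne_zero ha0 hder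
    exact h0 ((smul_eq_zero.1 (hzero χ)).resolve_left hμ)
  · exact mem_range_adGL_sub_one_of_mem_lrEigenspace s (hf χ) hab ha0

/-- **Springer 5.4.4, the `GL_n` step**: for `s` semisimple, every tangent vector at `1` of the
variety `m(s⁻¹ y) = 0` (`m` the minimal polynomial of `s⁻¹`) has matrix part in
`(Ad s - 1) 𝔤𝔩ₙ`; by antitonicity of `tangentSpaceAt` and
`conjEquationIdeal_le_vanishingIdeal` this applies to the tangent vectors at `1` of the closure
of `χ(G) = {s x s⁻¹ x⁻¹ | x ∈ G}` for any `G` normalised by `s`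
(`matrixOfCoord_mem_range_adGL_sub_one`). [cite: SpringerLAG1998, 5.4.4 (proof)] -/
theorem matrixOfCoord_mem_range_of_mem_tangentSpaceAt_conjEquationIdeal {s : GL n k}
    (hs : IsSemisimpleElt s) {v : GLCoord n → k}
    (hv : v ∈ Literature.RingTheory.KrullDimension.tangentSpaceAt (conjEquationIdeal s (minpoly k ((s⁻¹ : GL n k) : Matrix n n k)))
      (glCoordFun (1 : GL n k))) :
    matrixOfCoord v ∈ LinearMap.range (adGL s - 1) :=
  mem_range_adGL_sub_one_of_matrixPolyDeriv_eq_zero hs _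
    (matrixPolyDeriv_eq_zero_of_mem_tangentSpaceAt s _ hv)

/-- **`T_e (χ G)‾ ⊆ (Ad s - 1) 𝔤𝔩ₙ`** (Springer 5.4.4, proof: "there is `Y ∈ 𝔤𝔩ₙ` with
`X = dσ(Y) - Y`"): for `s` semisimple and any subgroup `G ≤ GL n k`, the matrix part of a tangent
vector at `1` of the closure of `χ(G) = {s x s⁻¹ x⁻¹ | x ∈ G}` (tangent space of its vanishing
ideal) lies in `(Ad s - 1) 𝔤𝔩ₙ`. [cite: SpringerLAG1998, 5.4.4 (proof)] -/
theorem matrixOfCoord_mem_range_adGL_sub_one {s : GL n k} (hs : IsSemisimpleElt s)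
    {G : Subgroup (GL n k)} {v : GLCoord n → k}
    (hv : v ∈ Literature.RingTheory.KrullDimension.tangentSpaceAt (MvPolynomial.vanishingIdeal k
      (glCoordFun '' ((fun x : GL n k => s * x * s⁻¹ * x⁻¹) '' (G : Set (GL n k)))))
      (glCoordFun (1 : GL n k))) :
    matrixOfCoord v ∈ LinearMap.range (adGL s - 1) := by
  refine matrixOfCoord_mem_range_of_mem_tangentSpaceAt_conjEquationIdeal hs fun f hf => ?_
  exact hv f (conjEquationIdeal_le_vanishingIdeal (G := G) s hf)

end LinearAlgebra

end Literature.NumberTheory.Automorphic
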